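import Summits.ResolutionOfSingularities.ResolutionOfSingularities.Theorems.FrobeniusClosingSteerNonRationalStepLocalBezout
import Mathlib.RingTheory.Localization.AtPrime.Basic
import Mathlib.RingTheory.MvPolynomial.Basic
import Mathlib.LinearAlgebra.Dimension.Finrank
import HarnessLib

/-!
# Steer / LEMMA I″ kernel (K-I2), FILE G: **the TRANSVERSAL READING** — the transversal derivation sends the chart form `F_b`
# into `ε(𝔭)` modulo the exceptional parameter

OURS (campaign res-hironaka, rung L ★L-G4, slot W4.1, crux `Steer` stmt-ResolutionOfSingularities-16345; res-L0-w41-plan-1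
RULING 274 (a) «I″ KERNEL = K-I2 BLUEPRINT», res-L0-w41-idea-3 g12 blueprint `K-I2-BLUEPRINT.md` ae0581fa150ab9c1 §2 G and
signature file `K-I2_signatures.lean` v2 e62c805738af0a97 §FileG — the statement of `transversal_apply_mem` below is that signature
VERBATIM, so that FILE H (`…NonRationalStepNotIsolated`) consumes it by name; replaces the role of no printed item; NOT a statement
of the manuscript under review [claim: Hironaka2017, status: under-review]; AI review is weaker than expert review). Theses-free,
definition-free. INTERFACE CONVENTION (blueprint): a derivation ALONG a ring map `ψ : B →+* A` is a bare function `D : B → A`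
with the two laws `D (x + y) = D x + D y`, `D (x * y) = ψ x * D y + ψ y * D x`.

SETTING. `S0 →ι B →ψ Ah →π N` (old local ring, blow-up chart, the hat of the new local ring, the hat modulo `X₀`), `Θ : B → K[T, U]`
the reduction of the chart modulo the exceptional parameter (`Θ ∘ ι = C ∘ ρ`, `Θ t_b = T`, `Θ u_b = U`), `ε : K[T, U] → N` with
`ε ∘ Θ = π ∘ ψ`, a maximal ideal `𝔫` (the near point) and a prime `𝔭 ≤ 𝔫` (the regular branch) containing `h ≠ 0` of degree `≤ δ'`,
the CONTRACTION clause `π ψ b ∈ π(𝔪_Ah ^ n) ⇒ Θ b ∈ 𝔫 ^ n` (FILE D), and a derivation `D` along `ψ` killing `t_b, u_b` whose values on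
old constants are, modulo `X₀`, affine-linear in `t_b, u_b` with old coefficients («only residues enter», FILE E).

THEOREM (`transversal_apply_mem`). If `F_b = Σ_i ι(c_i) t_b^{e₀ i} u_b^{e₁ i}` with `e₀ i + e₁ i ≤ d`, `s² F_b = b² + b'` with `ψ s` a
unit and `b' ∈ Q ^ d` for an ideal `Q` with `ψ(Q) ⊆ 𝔪_Ah`, `2 = 0` in `Ah`, and `δ'(d+1) < (d−1)·[K[T,U]/𝔫 : K]`, then `π (D F_b) ∈ ε(𝔭)·N`.

PROOF. ORDER: `D` kills squares (`2 = 0`), so `ψ(s)² · D F_b = D(s² F_b) = D b' ∈ 𝔪^{d−1}` by the order drop `D(Q^{k+1}) ⊆ 𝔪^k`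
(Leibniz, `ψ(Q) ⊆ 𝔪`); `ψ s` is a unit. POLYNOMIALITY: `D` kills the monomials `t_b^{e₀} u_b^{e₁}`, so
`π(D F_b) = Σ π ψ(t_b^{e₀} u_b^{e₁}) · π D(ι c_i) = π ψ(b₁)` with `b₁ = Σ (ι s₀ + ι s₁ t_b + ι s₂ u_b) t_b^{e₀} u_b^{e₁}`. CONTRACTION:
`Θ b₁ ∈ 𝔫^{d−1}`, and `Θ b₁ = Σ (C ρs₀ + C ρs₁ T + C ρs₂ U) T^{e₀} U^{e₁}` has total degree `≤ d + 1`. LOCAL BEZOUT (FILE A, (A2)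
`LemmaI2.mem_of_mem_pow_of_totalDegree_le` with `N = d − 1`, `D = d + 1`): `Θ b₁ ∈ 𝔭`, hence `π(D F_b) = π ψ b₁ = ε(Θ b₁) ∈ ε(𝔭)N`.
[cite: Matsumura1987, §25, Thm. 30.6] [folklore]
-/

noncomputable section

-- single-problem summit: the doubled namespace component `ResolutionOfSingularities` is forced
set_option linter.dupNamespace false

open IsLocalRing Module MvPolynomial

namespace Summit.ResolutionOfSingularities.ResolutionOfSingularities.Theorems.SwitchingDichotomy.LemmaI2

/-! ## §1 Derivations along a ring map (bare-function interface): elementary calculus -/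

namespace AlongMap

/-- A derivation along a ring map kills `0`. [folklore] -/
theorem map_zero {B Ah : Type} [CommRing B] [CommRing Ah] (D : B → Ah)
    (hadd : ∀ x y, D (x + y) = D x + D y) : D 0 = 0 := by
  have h := hadd 0 0
  rw [add_zero] at h
  have h' : D 0 + D 0 = D 0 + 0 := by rw [add_zero]; exact h.symm
  exact add_left_cancel h'

/-- A derivation along a ring map kills `1`. [folklore] -/
theorem map_one {B Ah : Type} [CommRing B] [CommRing Ah] (ψ : B →+* Ah) (D : B → Ah)
    (hmul : ∀ x y, D (x * y) = ψ x * D y + ψ y * D x) : D 1 = 0 := by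
  have h := hmul 1 1
  rw [mul_one, _root_.map_one, one_mul] at h
  have h' : D 1 + D 1 = D 1 + 0 := by rw [add_zero]; exact h.symm
  exact add_left_cancel h'

/-- A derivation along a ring map is additive over finite sums. [folklore] -/
theorem map_sum {B Ah : Type} [CommRing B] [CommRing Ah] (D : B → Ah)
    (hadd : ∀ x y, D (x + y) = D x + D y) {I : Type} (s : Finset I) (f : I → B) :
    D (∑ i ∈ s, f i) = ∑ i ∈ s, D (f i) := by
  classical
  induction s using Finset.induction_on with
  | empty => simp [map_zero D hadd]
  | insert a s ha ih => rw [Finset.sum_insert ha, Finset.sum_insert ha, hadd, ih]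

/-- A derivation along a ring map kills the powers of an element it kills. [folklore] -/
theorem map_pow_eq_zero {B Ah : Type} [CommRing B] [CommRing Ah] (ψ : B →+* Ah) (D : B → Ah)
    (hmul : ∀ x y, D (x * y) = ψ x * D y + ψ y * D x) {x : B} (hx : D x = 0) (k : ℕ) : D (x ^ k) = 0 := by
  induction k with
  | zero => simpa using map_one ψ D hmul
  | succ k ih => rw [pow_succ, hmul, hx, ih, mul_zero, mul_zero, add_zero]

/-- In characteristic `2` a derivation along a ring map kills squares. [folklore] -/
theorem map_sq_eq_zero {B Ah : Type} [CommRing B] [CommRing Ah] (ψ : B →+* Ah) (D : B → Ah)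
    (hmul : ∀ x y, D (x * y) = ψ x * D y + ψ y * D x) (h2 : (2 : Ah) = 0) (x : B) : D (x ^ 2) = 0 := by
  rw [pow_two, hmul, ← two_mul, h2, zero_mul]

/-- ORDER DROP along a ring map: if `ψ(Q) ⊆ 𝔪` then `D (Q ^ (k + 1)) ⊆ 𝔪 ^ k` (Leibniz on the generators `q · y` of
`Q · Q ^ k`). [cite: Matsumura1987, §25] [folklore] -/
theorem apply_mem_pow_of_mem_pow_succ {B Ah : Type} [CommRing B] [CommRing Ah] (ψ : B →+* Ah) (D : B → Ah)
    (hadd : ∀ x y, D (x + y) = D x + D y) (hmul : ∀ x y, D (x * y) = ψ x * D y + ψ y * D x)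
    (Q : Ideal B) (𝔪 : Ideal Ah) (hQ : ∀ y ∈ Q, ψ y ∈ 𝔪) (k : ℕ) {y : B} (hy : y ∈ Q ^ (k + 1)) :
    D y ∈ 𝔪 ^ k := by
  induction k generalizing y with
  | zero => simp
  | succ k ih =>
    rw [pow_succ'] at hy
    refine Submodule.mul_induction_on hy ?_ ?_
    · intro q hq z hz
      rw [hmul]
      have hψz : ψ z ∈ 𝔪 ^ (k + 1) := by
        have hle : Ideal.map ψ (Q ^ (k + 1)) ≤ 𝔪 ^ (k + 1) := by
          rw [Ideal.map_pow]
          exact Ideal.pow_right_mono (Ideal.map_le_iff_le_comap.mpr fun y hy => hQ y hy) _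
        exact hle (Ideal.mem_map_of_mem ψ hz)
      refine add_mem ?_ ?_
      · rw [pow_succ']
        exact Ideal.mul_mem_mul (hQ q hq) (ih hz)
      · exact Ideal.mul_mem_right _ _ hψz
    · intro x z hx hz
      rw [hadd]
      exact add_mem hx hz

end AlongMap

/-! ## §2 The transversal reading -/

variable {K : Type} [Field K]

/-- (G) **TRANSVERSAL READING.** For the chart form `F_b = Σ ι(c_i) t_b^{e₀ i} u_b^{e₁ i}` (`e₀ + e₁ ≤ d`) with `s² F_b = b² + b'`,
`ψ s` a unit, `b' ∈ Q^d`, `ψ(Q) ⊆ 𝔪`, a derivation `D` along `ψ` killing `t_b, u_b` with residue control on old constants, the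
contraction clause and `δ'(d+1) < (d−1)·[K[T,U]/𝔫 : K]`: `π (D F_b) ∈ ε(𝔭)·N`. (Order `≥ d − 1`, degree `≤ d + 1`, contraction,
LOCAL BEZOUT `LemmaI2.mem_of_mem_pow_of_totalDegree_le`.) OURS, K-I2 FILE G (signature v2 verbatim).
[cite: Matsumura1987, §25, Thm. 30.6] [folklore] -/
theorem transversal_apply_mem {S0 B Ah N : Type} [CommRing S0] [CommRing B] [CommRing Ah] [IsLocalRing Ah] [CommRing N]
    (h2 : (2 : Ah) = 0) (ι : S0 →+* B) (ρ : S0 →+* K)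
    (Θ : B →+* MvPolynomial (Fin 2) K) (hΘι : ∀ c, Θ (ι c) = C (ρ c)) {tb ub : B} (hΘt : Θ tb = X 0) (hΘu : Θ ub = X 1)
    (ψ : B →+* Ah) (π : Ah →+* N) (ε : MvPolynomial (Fin 2) K →+* N) (hε : ∀ b, ε (Θ b) = π (ψ b))
    (𝔫 : Ideal (MvPolynomial (Fin 2) K)) [𝔫.IsMaximal] (𝔭 : Ideal (MvPolynomial (Fin 2) K)) [𝔭.IsPrime] (h𝔭𝔫 : 𝔭 ≤ 𝔫)
    (hcontr : ∀ (n : ℕ) (b : B), π (ψ b) ∈ Ideal.map π (maximalIdeal Ah ^ n) → Θ b ∈ 𝔫 ^ n)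
    {h : MvPolynomial (Fin 2) K} {d δ' : ℕ} (hh : h ∈ 𝔭) (hh0 : h ≠ 0) (hdeg : h.totalDegree ≤ δ')
    (hineq : δ' * (d + 1) < (d - 1) * finrank K (MvPolynomial (Fin 2) K ⧸ 𝔫))
    {Fb : B} {I : Type} (supp : Finset I) (c : I → S0) (e₀ e₁ : I → ℕ) (hsupp : ∀ i ∈ supp, e₀ i + e₁ i ≤ d)
    (hFb : Fb = ∑ i ∈ supp, ι (c i) * tb ^ e₀ i * ub ^ e₁ i)
    (Q : Ideal B) (hQ : ∀ y ∈ Q, ψ y ∈ maximalIdeal Ah) {s b b' : B} (hsu : IsUnit (ψ s)) (hb' : b' ∈ Q ^ d)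
    (hsF : s ^ 2 * Fb = b ^ 2 + b')
    (D : B → Ah) (hadd : ∀ x y, D (x + y) = D x + D y) (hmul : ∀ x y, D (x * y) = ψ x * D y + ψ y * D x)
    (hDt : D tb = 0) (hDu : D ub = 0)
    (hres : ∀ c : S0, ∃ s₀ s₁ s₂ : S0, π (D (ι c)) = π (ψ (ι s₀ + ι s₁ * tb + ι s₂ * ub))) :
    π (D Fb) ∈ Ideal.map ε 𝔭 := by
  classical
  -- (1) ORDER: `D F_b ∈ 𝔪 ^ (d - 1)`
  have hDsF : D (s ^ 2 * Fb) = ψ s ^ 2 * D Fb := by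
    rw [hmul, AlongMap.map_sq_eq_zero ψ D hmul h2, mul_zero, add_zero, map_pow]
  have hDb' : D b' ∈ maximalIdeal Ah ^ (d - 1) := by
    rcases Nat.eq_zero_or_pos d with hd | hd
    · subst hd; simp
    · obtain ⟨k, rfl⟩ : ∃ k, d = k + 1 := ⟨d - 1, by omega⟩
      simpa using AlongMap.apply_mem_pow_of_mem_pow_succ ψ D hadd hmul Q (maximalIdeal Ah) hQ k hb'
  have hDFb : D Fb ∈ maximalIdeal Ah ^ (d - 1) := by
    have h1 : ψ s ^ 2 * D Fb ∈ maximalIdeal Ah ^ (d - 1) := by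
      rw [← hDsF, hsF, hadd, AlongMap.map_sq_eq_zero ψ D hmul h2, zero_add]
      exact hDb'
    obtain ⟨u, hu⟩ := hsu.pow 2
    have h3 : (↑u⁻¹ : Ah) * (ψ s ^ 2 * D Fb) = D Fb := by
      rw [← hu, ← mul_assoc, Units.inv_mul, one_mul]
    rw [← h3]
    exact Ideal.mul_mem_left _ _ h1
  -- (2) POLYNOMIALITY: `π (D F_b) = π (ψ b₁)`
  choose s₀ s₁ s₂ hs using hres
  have hDmon : ∀ i, D (tb ^ e₀ i * ub ^ e₁ i) = 0 := by
    intro i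
    rw [hmul, AlongMap.map_pow_eq_zero ψ D hmul hDu, AlongMap.map_pow_eq_zero ψ D hmul hDt, mul_zero, mul_zero,
      add_zero]
  set b₁ : B := ∑ i ∈ supp, (ι (s₀ (c i)) + ι (s₁ (c i)) * tb + ι (s₂ (c i)) * ub) * (tb ^ e₀ i * ub ^ e₁ i)
    with hb₁
  have hπD : π (D Fb) = π (ψ b₁) := by
    have hterm : ∀ i, π (D (ι (c i) * tb ^ e₀ i * ub ^ e₁ i)) =
        π (ψ ((ι (s₀ (c i)) + ι (s₁ (c i)) * tb + ι (s₂ (c i)) * ub) * (tb ^ e₀ i * ub ^ e₁ i))) := by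
      intro i
      rw [mul_assoc, hmul, hDmon i, mul_zero, zero_add, map_mul, hs (c i)]
      simp only [map_mul, map_add, map_pow]
      ring
    rw [hFb, AlongMap.map_sum D hadd, map_sum, hb₁, map_sum, map_sum]
    exact Finset.sum_congr rfl fun i _ => hterm i
  -- (3) CONTRACTION: `Θ b₁ ∈ 𝔫 ^ (d - 1)`
  have hΘb₁ : Θ b₁ ∈ 𝔫 ^ (d - 1) := by
    apply hcontr
    rw [← hπD]
    exact Ideal.mem_map_of_mem π hDFb
  -- (4) DEGREE: `Θ b₁` has total degree `≤ d + 1`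
  have hΘb₁eq : Θ b₁ = ∑ i ∈ supp, (C (ρ (s₀ (c i))) + C (ρ (s₁ (c i))) * X 0 + C (ρ (s₂ (c i))) * X 1) *
      (X 0 ^ e₀ i * X 1 ^ e₁ i) := by
    rw [hb₁, map_sum]
    refine Finset.sum_congr rfl fun i _ => ?_
    simp only [map_mul, map_add, map_pow, hΘι, hΘt, hΘu]
  have hdegP : (Θ b₁).totalDegree ≤ d + 1 := by
    rw [hΘb₁eq]
    refine totalDegree_finsetSum_le fun i hi => ?_
    have hlin : (C (ρ (s₀ (c i))) + C (ρ (s₁ (c i))) * X 0 + C (ρ (s₂ (c i))) * X 1 :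
        MvPolynomial (Fin 2) K).totalDegree ≤ 1 := by
      refine (totalDegree_add _ _).trans (max_le ((totalDegree_add _ _).trans (max_le ?_ ?_)) ?_)
      · rw [totalDegree_C]; exact Nat.zero_le _
      · exact (totalDegree_mul _ _).trans (by rw [totalDegree_C, totalDegree_X])
      · exact (totalDegree_mul _ _).trans (by rw [totalDegree_C, totalDegree_X])
    have hmon : (X 0 ^ e₀ i * X 1 ^ e₁ i : MvPolynomial (Fin 2) K).totalDegree ≤ e₀ i + e₁ i := by
      refine (totalDegree_mul _ _).trans ?_
      rw [totalDegree_X_pow, totalDegree_X_pow]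
    refine (totalDegree_mul _ _).trans ?_
    have := hsupp i hi
    omega
  -- (5) LOCAL BEZOUT (FILE A, (A2)) with `N = d - 1`, `D = d + 1`
  have hP𝔭 : Θ b₁ ∈ 𝔭 :=
    mem_of_mem_pow_of_totalDegree_le 𝔫 𝔭 h𝔭𝔫 hh hh0 hdeg hΘb₁ hdegP (by rwa [mul_comm (d - 1)] at hineq ⊢)
  rw [hπD, ← hε]
  exact Ideal.mem_map_of_mem ε hP𝔭

end Summit.ResolutionOfSingularities.ResolutionOfSingularities.Theorems.SwitchingDichotomy.LemmaI2

end
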